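import Mathlib
import Summits.QuantumAdvantage.QuantumAdvantage.Theorems.MobiusLadderQuadraticDigitPhasesStubNoExactA
import Summits.QuantumAdvantage.QuantumAdvantage.Theorems.MobiusLadderQuadraticDigitPhasesStubStaircasePred

/-!
# No exact twisted cycle, part B: sign analysis on a fully charged vector

Lemmas for the lead's stub `stub_noExactTwistedCycle` of the crux `MobiusLadder.QuadraticDigitPhases`
(stmt-QuantumAdvantage-1391), line `Sketch`; continues part A (`…StubNoExactA`: exactness toolkit,
letter entries, support spreading).

The carry cells `(r, r')` (`r q < (r'+1) p ∧ r' p < (r+1) q`) form a monotone lattice path from `(0,0)`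
to `(p-1, q-1)` (`stub_staircasePred`), and two consecutive cells are merged by one of the two digit
moves (`merge_horiz`, `merge_vert`: across the breakpoint `k/p` the digit `k mod 2` merges).  Hence,
if a vector `v` charges every cell and a letter `M_{ab}` acts exactly on it (no `ℓ¹` loss), the
discordance test (`merge_pos`, from `noCancel`) propagates along the path: the twisted vector
`ε_{ab} v` has ONE strict sign on all cells (`sign_propagate`).  The middle cell — the common target of
`(p-1,q-1)` under digit `0` and of `(0,0)` under digit `1`, where the digit-`1` twist carries the extra
sign `(a ? -1 : 1)(b ? -1 : 1)` — then forces `a = b` (`fst_eq_snd`): the letters `M₁₀`, `M₀₁` are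
never exact on a fully charged vector.  Also here: every cell is the digit target of a charged
reachable state (`pred_target`), and the row sums / reachability bookkeeping of the generalized
letters `M_{ab}`, `Π = 𝟙 ⊗ π` (`letter_rows`, `letter_reach`).
-/

set_option linter.dupNamespace false -- D-0017: single-problem summit ⇒ `QuantumAdvantage.QuantumAdvantage` by design

namespace Summit.QuantumAdvantage.QuantumAdvantage.Theorems.MobiusLadderQuadraticDigitPhasesStubNoExactB

open Finset
open scoped Matrix
open Summit.QuantumAdvantage.QuantumAdvantage.Theorems.MobiusLadderQuadraticDigitPhasesStubNoExactA
open Summit.QuantumAdvantage.QuantumAdvantage.Theorems.MobiusLadderQuadraticDigitPhasesStubUwcOfNoExact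
  (l1_vecMul_le l1_mul_prod_le supp_vecMul)
open Summit.QuantumAdvantage.QuantumAdvantage.Theorems.MobiusLadderQuadraticDigitPhasesStubWordDecayOfUWC
  (sum_abs_letter_le abs_twist reach_step support_vecMul_prod)
open Summit.QuantumAdvantage.QuantumAdvantage.Theorems.MobiusLadderQuadraticDigitPhasesStubStaircasePred
  (stub_staircasePred)

-- adapted from …Theorems.MobiusLadderQuadraticDigitPhasesStubDwdOfWords.carry_succ (= it; private copy as in part A)
/-- One digit move keeps carries of the shape `⌊p T/2^c⌋`:
`⌊p (2^c t + T) / 2^{c+1}⌋ = ⌊(p t + ⌊p T/2^c⌋)/2⌋`. -/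
private theorem carry_step (p c t T : ℕ) :
    p * (2 ^ c * t + T) / 2 ^ (c + 1) = (p * t + p * T / 2 ^ c) / 2 := by
  rw [pow_succ, ← Nat.div_div_eq_div_mul, show p * (2 ^ c * t + T) = p * T + p * t * 2 ^ c by ring,
    Nat.add_mul_div_right _ _ (Nat.two_pow_pos c), add_comm]

/-! ## Sign analysis on a fully charged vector -/

section SignAnalysis

variable {p q : ℕ} (hp : p.Prime) (hq : q.Prime) (hpq : p ≠ q) (hp2 : 2 < p) (hq2 : 2 < q)
variable {M : Bool × Bool → Matrix (Fin p × Fin q) (Fin p × Fin q) ℝ}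
  (hM : M = fun ab : Bool × Bool => (Matrix.of fun (x y : Fin p × Fin q) =>
      ∑ t ∈ ({0, 1} : Finset ℕ),
        if (y.1 : ℕ) = (p * t + x.1) / 2 ∧ (y.2 : ℕ) = (q * t + x.2) / 2 then
          (1 / 2 : ℝ) * (if ab.1 then (-1 : ℝ) ^ ((p * t + x.1) % 2) else 1) *
            (if ab.2 then (-1 : ℝ) ^ ((q * t + x.2) % 2) else 1)
        else 0))
variable {π : Fin p × Fin q → ℝ}
  (hπpos : ∀ s : Fin p × Fin q,
    (∃ c T : ℕ, T < 2 ^ c ∧ (s.1 : ℕ) = p * T / 2 ^ c ∧ (s.2 : ℕ) = q * T / 2 ^ c) → 0 < π s)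
  (hπzero : ∀ s : Fin p × Fin q,
    ¬ (∃ c T : ℕ, T < 2 ^ c ∧ (s.1 : ℕ) = p * T / 2 ^ c ∧ (s.2 : ℕ) = q * T / 2 ^ c) → π s = 0)
  (hπsum : ∑ s : Fin p × Fin q, π s = 1)
  (hπinv : ∀ y : Fin p × Fin q, ∑ x : Fin p × Fin q, π x * (Matrix.of fun (x y : Fin p × Fin q) =>
    ∑ t ∈ ({0, 1} : Finset ℕ),
      if (y.1 : ℕ) = (p * t + x.1) / 2 ∧ (y.2 : ℕ) = (q * t + x.2) / 2 then (1 / 2 : ℝ) else 0) x y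
      = π y)
variable {Λ : Option (Bool × Bool) → Matrix (Fin p × Fin q) (Fin p × Fin q) ℝ}
  (hΛ : Λ = fun l : Option (Bool × Bool) => l.elim (Matrix.of fun (_ y : Fin p × Fin q) => π y) M)

/-- Sign bookkeeping: `ab > 0` and `ac > 0` give `bc > 0`. -/
theorem pos_of_pos_pos {a b c : ℝ} (h1 : 0 < a * b) (h2 : 0 < a * c) : 0 < b * c := by
  rcases pos_and_pos_or_neg_and_neg_of_mul_pos h1 with ⟨ha, hb⟩ | ⟨ha, hb⟩ <;>
    rcases pos_and_pos_or_neg_and_neg_of_mul_pos h2 with ⟨ha', hc⟩ | ⟨ha', hc⟩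
  · exact mul_pos hb hc
  · linarith
  · linarith
  · exact mul_pos_of_neg_of_neg hb hc

/-- At digit `1` the twist pattern picks up the sign `s_{ab} = (a ? -1 : 1)(b ? -1 : 1)` (`p`, `q` odd). -/
theorem twist_one (hpo : p % 2 = 1) (hqo : q % 2 = 1) (a b : Bool) (x : Fin p × Fin q) :
    (if a then (-1 : ℝ) ^ ((p * 1 + x.1) % 2) else 1) *
        (if b then (-1 : ℝ) ^ ((q * 1 + x.2) % 2) else 1)
      = ((if a then (-1 : ℝ) else 1) * (if b then (-1 : ℝ) else 1)) *
        ((if a then (-1 : ℝ) ^ ((x.1 : ℕ) % 2) else 1) *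
          (if b then (-1 : ℝ) ^ ((x.2 : ℕ) % 2) else 1)) := by
  rcases Nat.mod_two_eq_zero_or_one x.1 with h1 | h1 <;>
  rcases Nat.mod_two_eq_zero_or_one x.2 with h2 | h2
  all_goals
    have e1 : (p * 1 + (x.1 : ℕ)) % 2 = 1 - (x.1 : ℕ) % 2 := by omega
    have e2 : (q * 1 + (x.2 : ℕ)) % 2 = 1 - (x.2 : ℕ) % 2 := by omega
    simp only [e1, e2, h1, h2]
    cases a <;> cases b <;> norm_num

include hp hq hp2 hq2 hM in
/-- DISCORDANCE TEST.  Under an exact letter `M_{ab}`, two distinct charged states merged by the same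
digit `t` carry `ε_{ab}`-twisted values of the same strict sign. -/
theorem merge_pos (a b : Bool) (v : Fin p × Fin q → ℝ)
    (hex : ∑ z, |(v ᵥ* M (a, b)) z| = ∑ s, |v s|) (x x' y : Fin p × Fin q) (hxx' : x ≠ x')
    (hvx : v x ≠ 0) (hvx' : v x' ≠ 0) (t : ℕ) (ht : t ≤ 1)
    (hy : (y.1 : ℕ) = (p * t + x.1) / 2 ∧ (y.2 : ℕ) = (q * t + x.2) / 2)
    (hy' : (y.1 : ℕ) = (p * t + x'.1) / 2 ∧ (y.2 : ℕ) = (q * t + x'.2) / 2) :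
    0 < ((if a then (-1 : ℝ) ^ ((x.1 : ℕ) % 2) else 1) *
          (if b then (-1 : ℝ) ^ ((x.2 : ℕ) % 2) else 1) * v x) *
        ((if a then (-1 : ℝ) ^ ((x'.1 : ℕ) % 2) else 1) *
          (if b then (-1 : ℝ) ^ ((x'.2 : ℕ) % 2) else 1) * v x') := by
  classical
  have hpo : p % 2 = 1 := hp.eq_two_or_odd.resolve_left (by omega)
  have hqo : q % 2 = 1 := hq.eq_two_or_odd.resolve_left (by omega)
  have h0 := noCancel (M (a, b)) (sum_abs_letter_le M hM (a, b)) v hex y x x' hxx'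
  rw [letter_entry hp.two_le M hM (a, b) x y t ht hy,
    letter_entry hp.two_le M hM (a, b) x' y t ht hy'] at h0
  have hne : v x * (1 / 2 * ((if a then (-1 : ℝ) ^ ((p * t + x.1) % 2) else 1) *
      (if b then (-1 : ℝ) ^ ((q * t + x.2) % 2) else 1))) *
      (v x' * (1 / 2 * ((if a then (-1 : ℝ) ^ ((p * t + x'.1) % 2) else 1) *
      (if b then (-1 : ℝ) ^ ((q * t + x'.2) % 2) else 1)))) ≠ 0 :=
    mul_ne_zero (mul_ne_zero hvx (mul_ne_zero (by norm_num) (twist_ne_zero _ _ _ _)))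
      (mul_ne_zero hvx' (mul_ne_zero (by norm_num) (twist_ne_zero _ _ _ _)))
  have hpos := lt_of_le_of_ne h0 (fun h => hne h.symm)
  rcases Nat.le_one_iff_eq_zero_or_eq_one.mp ht with rfl | rfl
  · simp only [mul_zero, zero_add] at hpos
    have key : v x * (1 / 2 * ((if a then (-1 : ℝ) ^ ((x.1 : ℕ) % 2) else 1) *
        (if b then (-1 : ℝ) ^ ((x.2 : ℕ) % 2) else 1))) *
        (v x' * (1 / 2 * ((if a then (-1 : ℝ) ^ ((x'.1 : ℕ) % 2) else 1) *
        (if b then (-1 : ℝ) ^ ((x'.2 : ℕ) % 2) else 1))))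
        = 1 / 4 * (((if a then (-1 : ℝ) ^ ((x.1 : ℕ) % 2) else 1) *
          (if b then (-1 : ℝ) ^ ((x.2 : ℕ) % 2) else 1) * v x) *
        ((if a then (-1 : ℝ) ^ ((x'.1 : ℕ) % 2) else 1) *
          (if b then (-1 : ℝ) ^ ((x'.2 : ℕ) % 2) else 1) * v x')) := by ring
    rw [key] at hpos
    linarith
  · rw [twist_one hpo hqo a b x, twist_one hpo hqo a b x'] at hpos
    have hS : ((if a then (-1 : ℝ) else 1) * (if b then (-1 : ℝ) else 1)) *
        ((if a then (-1 : ℝ) else 1) * (if b then (-1 : ℝ) else 1)) = 1 := by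
      cases a <;> cases b <;> norm_num
    have key : v x * (1 / 2 * (((if a then (-1 : ℝ) else 1) * (if b then (-1 : ℝ) else 1)) *
        ((if a then (-1 : ℝ) ^ ((x.1 : ℕ) % 2) else 1) *
          (if b then (-1 : ℝ) ^ ((x.2 : ℕ) % 2) else 1)))) *
        (v x' * (1 / 2 * (((if a then (-1 : ℝ) else 1) * (if b then (-1 : ℝ) else 1)) *
        ((if a then (-1 : ℝ) ^ ((x'.1 : ℕ) % 2) else 1) *
          (if b then (-1 : ℝ) ^ ((x'.2 : ℕ) % 2) else 1)))))
        = 1 / 4 * (((if a then (-1 : ℝ) else 1) * (if b then (-1 : ℝ) else 1)) *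
            ((if a then (-1 : ℝ) else 1) * (if b then (-1 : ℝ) else 1))) *
          (((if a then (-1 : ℝ) ^ ((x.1 : ℕ) % 2) else 1) *
            (if b then (-1 : ℝ) ^ ((x.2 : ℕ) % 2) else 1) * v x) *
          ((if a then (-1 : ℝ) ^ ((x'.1 : ℕ) % 2) else 1) *
            (if b then (-1 : ℝ) ^ ((x'.2 : ℕ) % 2) else 1) * v x')) := by ring
    rw [key, hS] at hpos
    linarith

include hp in
/-- Horizontal neighbours `(r, r')`, `(r+1, r')` are merged by the digit `t = r mod 2` (`p` odd). -/
theorem merge_horiz (hp2 : 2 < p) (xm x : Fin p × Fin q) (h1 : (x.1 : ℕ) = xm.1 + 1)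
    (h2 : (x.2 : ℕ) = xm.2) :
    ∃ t : ℕ, t ≤ 1 ∧ ∃ y : Fin p × Fin q,
      ((y.1 : ℕ) = (p * t + xm.1) / 2 ∧ (y.2 : ℕ) = (q * t + xm.2) / 2) ∧
      ((y.1 : ℕ) = (p * t + x.1) / 2 ∧ (y.2 : ℕ) = (q * t + x.2) / 2) := by
  have hpo : p % 2 = 1 := hp.eq_two_or_odd.resolve_left (by omega)
  rcases Nat.mod_two_eq_zero_or_one xm.1 with he | he
  · refine ⟨0, zero_le_one, (⟨(p * 0 + xm.1) / 2, succ_lt xm.1.isLt zero_le_one⟩,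
      ⟨(q * 0 + xm.2) / 2, succ_lt xm.2.isLt zero_le_one⟩), ⟨rfl, rfl⟩, ?_, ?_⟩
    · show (p * 0 + (xm.1 : ℕ)) / 2 = (p * 0 + x.1) / 2
      rw [h1]; omega
    · show (q * 0 + (xm.2 : ℕ)) / 2 = (q * 0 + x.2) / 2
      rw [h2]
  · refine ⟨1, le_rfl, (⟨(p * 1 + xm.1) / 2, succ_lt xm.1.isLt le_rfl⟩,
      ⟨(q * 1 + xm.2) / 2, succ_lt xm.2.isLt le_rfl⟩), ⟨rfl, rfl⟩, ?_, ?_⟩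
    · show (p * 1 + (xm.1 : ℕ)) / 2 = (p * 1 + x.1) / 2
      rw [h1]; omega
    · show (q * 1 + (xm.2 : ℕ)) / 2 = (q * 1 + x.2) / 2
      rw [h2]

include hq in
/-- Vertical neighbours `(r, r')`, `(r, r'+1)` are merged by the digit `t = r' mod 2` (`q` odd). -/
theorem merge_vert (hq2 : 2 < q) (xm x : Fin p × Fin q) (h1 : (x.1 : ℕ) = xm.1)
    (h2 : (x.2 : ℕ) = xm.2 + 1) :
    ∃ t : ℕ, t ≤ 1 ∧ ∃ y : Fin p × Fin q,
      ((y.1 : ℕ) = (p * t + xm.1) / 2 ∧ (y.2 : ℕ) = (q * t + xm.2) / 2) ∧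
      ((y.1 : ℕ) = (p * t + x.1) / 2 ∧ (y.2 : ℕ) = (q * t + x.2) / 2) := by
  have hqo : q % 2 = 1 := hq.eq_two_or_odd.resolve_left (by omega)
  rcases Nat.mod_two_eq_zero_or_one xm.2 with he | he
  · refine ⟨0, zero_le_one, (⟨(p * 0 + xm.1) / 2, succ_lt xm.1.isLt zero_le_one⟩,
      ⟨(q * 0 + xm.2) / 2, succ_lt xm.2.isLt zero_le_one⟩), ⟨rfl, rfl⟩, ?_, ?_⟩
    · show (p * 0 + (xm.1 : ℕ)) / 2 = (p * 0 + x.1) / 2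
      rw [h1]
    · show (q * 0 + (xm.2 : ℕ)) / 2 = (q * 0 + x.2) / 2
      rw [h2]; omega
  · refine ⟨1, le_rfl, (⟨(p * 1 + xm.1) / 2, succ_lt xm.1.isLt le_rfl⟩,
      ⟨(q * 1 + xm.2) / 2, succ_lt xm.2.isLt le_rfl⟩), ⟨rfl, rfl⟩, ?_, ?_⟩
    · show (p * 1 + (xm.1 : ℕ)) / 2 = (p * 1 + x.1) / 2
      rw [h1]
    · show (q * 1 + (xm.2 : ℕ)) / 2 = (q * 1 + x.2) / 2
      rw [h2]; omega

include hp hq hpq hp2 hq2 hM in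
/-- SIGN PROPAGATION.  If `v` charges every cell and the letter `M_{ab}` is exact on `v`, then the
twisted vector `ε_{ab} v` has one strict sign on all cells (that of `v (0,0)`): consecutive cells are
merged by a digit (`merge_horiz`, `merge_vert`), so the discordance test applies along the lattice path
of cells (`stub_staircasePred`, induction on `r + r'`). -/
theorem sign_propagate (a b : Bool) (v : Fin p × Fin q → ℝ)
    (hfull : ∀ x : Fin p × Fin q,
      (x.1 : ℕ) * q < ((x.2 : ℕ) + 1) * p ∧ (x.2 : ℕ) * p < ((x.1 : ℕ) + 1) * q → v x ≠ 0)
    (hex : ∑ z, |(v ᵥ* M (a, b)) z| = ∑ s, |v s|) :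
    ∀ x : Fin p × Fin q,
      (x.1 : ℕ) * q < ((x.2 : ℕ) + 1) * p ∧ (x.2 : ℕ) * p < ((x.1 : ℕ) + 1) * q →
      0 < (if a then (-1 : ℝ) ^ ((x.1 : ℕ) % 2) else 1) *
          (if b then (-1 : ℝ) ^ ((x.2 : ℕ) % 2) else 1) * v x *
        v ((⟨0, hp.pos⟩, ⟨0, hq.pos⟩) : Fin p × Fin q) := by
  have hoo : ((0 : ℕ)) * q < ((0 : ℕ) + 1) * p ∧ (0 : ℕ) * p < ((0 : ℕ) + 1) * q := by
    constructor <;> simp [hp.pos, hq.pos]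
  have hvo := hfull ((⟨0, hp.pos⟩, ⟨0, hq.pos⟩) : Fin p × Fin q) hoo
  suffices H : ∀ n : ℕ, ∀ x : Fin p × Fin q, (x.1 : ℕ) + x.2 = n →
      (x.1 : ℕ) * q < ((x.2 : ℕ) + 1) * p ∧ (x.2 : ℕ) * p < ((x.1 : ℕ) + 1) * q →
      0 < (if a then (-1 : ℝ) ^ ((x.1 : ℕ) % 2) else 1) *
          (if b then (-1 : ℝ) ^ ((x.2 : ℕ) % 2) else 1) * v x *
        v ((⟨0, hp.pos⟩, ⟨0, hq.pos⟩) : Fin p × Fin q) from fun x hx => H _ x rfl hx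
  intro n
  induction' n using Nat.strong_induction_on with n ih
  intro x hxn hcell
  by_cases hx0 : (x.1 : ℕ) = 0 ∧ (x.2 : ℕ) = 0
  · have hxo : x = ((⟨0, hp.pos⟩, ⟨0, hq.pos⟩) : Fin p × Fin q) :=
      Prod.ext (Fin.ext hx0.1) (Fin.ext hx0.2)
    rw [hxo]
    simp only [Nat.zero_mod, pow_zero, ite_self, one_mul]
    exact mul_self_pos.2 hvo
  · have hne : ((x.1 : ℕ), (x.2 : ℕ)) ≠ (0, 0) := fun h => hx0 (Prod.mk.inj h)
    rcases stub_staircasePred p q hp hq hpq hp2 hq2 x.1 x.2 x.1.isLt x.2.isLt hcell.1 hcell.2 hne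
      with ⟨hr, hc1, hc2⟩ | ⟨hr, hc1, hc2⟩
    · -- horizontal predecessor `(r - 1, r')`
      obtain ⟨xm, hxm1, hxm2⟩ : ∃ xm : Fin p × Fin q, (xm.1 : ℕ) = x.1 - 1 ∧ (xm.2 : ℕ) = x.2 :=
        ⟨(⟨(x.1 : ℕ) - 1, by omega⟩, x.2), rfl, rfl⟩
      have hcm : (xm.1 : ℕ) * q < ((xm.2 : ℕ) + 1) * p ∧ (xm.2 : ℕ) * p < ((xm.1 : ℕ) + 1) * q := by
        rw [hxm1, hxm2, Nat.sub_add_cancel hr]; exact ⟨hc1, hc2⟩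
      have ihm := ih ((xm.1 : ℕ) + xm.2) (by omega) xm rfl hcm
      obtain ⟨t, ht, y, hy, hy'⟩ := merge_horiz hp hp2 xm x (by omega) (by omega)
      have hxx : xm ≠ x := fun h => by rw [h] at hxm1; omega
      have hm := merge_pos hp hq hp2 hq2 hM a b v hex xm x y hxx (hfull xm hcm) (hfull x hcell) t ht
        hy hy'
      exact pos_of_pos_pos hm ihm
    · -- vertical predecessor `(r, r' - 1)`
      obtain ⟨xm, hxm1, hxm2⟩ : ∃ xm : Fin p × Fin q, (xm.1 : ℕ) = x.1 ∧ (xm.2 : ℕ) = x.2 - 1 :=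
        ⟨(x.1, ⟨(x.2 : ℕ) - 1, by omega⟩), rfl, rfl⟩
      have hcm : (xm.1 : ℕ) * q < ((xm.2 : ℕ) + 1) * p ∧ (xm.2 : ℕ) * p < ((xm.1 : ℕ) + 1) * q := by
        rw [hxm1, hxm2, Nat.sub_add_cancel hr]; exact ⟨hc1, hc2⟩
      have ihm := ih ((xm.1 : ℕ) + xm.2) (by omega) xm rfl hcm
      obtain ⟨t, ht, y, hy, hy'⟩ := merge_vert hq hq2 xm x (by omega) (by omega)
      have hxx : xm ≠ x := fun h => by rw [h] at hxm2; omega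
      have hm := merge_pos hp hq hp2 hq2 hM a b v hex xm x y hxx (hfull xm hcm) (hfull x hcell) t ht
        hy hy'
      exact pos_of_pos_pos hm ihm

include hp hq hpq hp2 hq2 hM in
/-- THE MIDDLE CELL KILLS `M₁₀`, `M₀₁`.  On a fully charged vector an exact letter has `a = b`:
the digit-`0` target of the last cell `(p-1, q-1)` and the digit-`1` target of `(0,0)` coincide, and
there the digit-`1` twist carries the extra sign `(a ? -1 : 1)(b ? -1 : 1)`. -/
theorem fst_eq_snd (a b : Bool) (v : Fin p × Fin q → ℝ)
    (hfull : ∀ x : Fin p × Fin q,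
      (x.1 : ℕ) * q < ((x.2 : ℕ) + 1) * p ∧ (x.2 : ℕ) * p < ((x.1 : ℕ) + 1) * q → v x ≠ 0)
    (hex : ∑ z, |(v ᵥ* M (a, b)) z| = ∑ s, |v s|) : a = b := by
  classical
  by_contra hab
  have hpo : p % 2 = 1 := hp.eq_two_or_odd.resolve_left (by omega)
  have hqo : q % 2 = 1 := hq.eq_two_or_odd.resolve_left (by omega)
  have hsg := sign_propagate hp hq hpq hp2 hq2 hM a b v hfull hex
  obtain ⟨xl, hxl1, hxl2⟩ : ∃ xl : Fin p × Fin q, (xl.1 : ℕ) = p - 1 ∧ (xl.2 : ℕ) = q - 1 :=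
    ⟨(⟨p - 1, by omega⟩, ⟨q - 1, by omega⟩), rfl, rfl⟩
  obtain ⟨mid, hm1, hm2⟩ : ∃ mid : Fin p × Fin q, (mid.1 : ℕ) = (p - 1) / 2 ∧ (mid.2 : ℕ) = (q - 1) / 2 :=
    ⟨(⟨(p - 1) / 2, by omega⟩, ⟨(q - 1) / 2, by omega⟩), rfl, rfl⟩
  have hcl : (xl.1 : ℕ) * q < ((xl.2 : ℕ) + 1) * p ∧ (xl.2 : ℕ) * p < ((xl.1 : ℕ) + 1) * q := by
    rw [hxl1, hxl2, Nat.sub_add_cancel hp.one_lt.le, Nat.sub_add_cancel hq.one_lt.le]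
    exact ⟨by rw [mul_comm q p]; exact Nat.mul_lt_mul_of_pos_right (by omega) hq.pos,
      by rw [mul_comm p q]; exact Nat.mul_lt_mul_of_pos_right (by omega) hp.pos⟩
  have hy0 : (mid.1 : ℕ) = (p * 0 + xl.1) / 2 ∧ (mid.2 : ℕ) = (q * 0 + xl.2) / 2 := by
    rw [hm1, hm2, hxl1, hxl2]; constructor <;> simp
  have hy1 : (mid.1 : ℕ) = (p * 1 + ((⟨0, hp.pos⟩, ⟨0, hq.pos⟩) : Fin p × Fin q).1) / 2 ∧
      (mid.2 : ℕ) = (q * 1 + ((⟨0, hp.pos⟩, ⟨0, hq.pos⟩) : Fin p × Fin q).2) / 2 := by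
    rw [hm1, hm2]; constructor <;> simp <;> omega
  have hxlo : xl ≠ ((⟨0, hp.pos⟩, ⟨0, hq.pos⟩) : Fin p × Fin q) := fun h => by
    rw [h] at hxl1; simp at hxl1; omega
  have h0 := noCancel (M (a, b)) (sum_abs_letter_le M hM (a, b)) v hex mid xl _ hxlo
  rw [letter_entry hp.two_le M hM (a, b) xl mid 0 zero_le_one hy0,
    letter_entry hp.two_le M hM (a, b) _ mid 1 le_rfl hy1] at h0
  have hS : (if a then (-1 : ℝ) ^ ((p * 1 + (((⟨0, hp.pos⟩, ⟨0, hq.pos⟩) : Fin p × Fin q).1 : ℕ)) % 2)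
      else 1) * (if b then (-1 : ℝ) ^ ((q * 1 + (((⟨0, hp.pos⟩, ⟨0, hq.pos⟩) : Fin p × Fin q).2 : ℕ)) % 2)
      else 1) = -1 := by
    have e1 : (p * 1 + 0) % 2 = 1 := by omega
    have e2 : (q * 1 + 0) % 2 = 1 := by omega
    simp only [e1, e2, pow_one]
    cases a <;> cases b <;> first | exact absurd rfl hab | norm_num
  rw [hS] at h0
  simp only [mul_zero, zero_add] at h0
  have key := hsg xl hcl
  nlinarith [key, h0]

include hp hq hpq hp2 hq2 hM hπpos hπzero hπinv in
/-- Every cell is the digit target of a charged cell: predecessor along the dyadic reachability. -/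
theorem pred_target (ab : Bool × Bool) (v : Fin p × Fin q → ℝ)
    (hfull : ∀ x : Fin p × Fin q,
      (x.1 : ℕ) * q < ((x.2 : ℕ) + 1) * p ∧ (x.2 : ℕ) * p < ((x.1 : ℕ) + 1) * q → v x ≠ 0)
    (hex : ∑ z, |(v ᵥ* M ab) z| = ∑ s, |v s|) (y : Fin p × Fin q)
    (hy : (y.1 : ℕ) * q < ((y.2 : ℕ) + 1) * p ∧ (y.2 : ℕ) * p < ((y.1 : ℕ) + 1) * q) :
    (v ᵥ* M ab) y ≠ 0 := by
  classical
  obtain ⟨c, T, hT, hy1, hy2⟩ := reach_of_cell hp hq hpq hp2 hq2 M hM π hπpos hπzero hπinv y hy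
  rcases c with _ | c
  · have hT0 : T = 0 := by simpa using hT
    subst hT0
    have hoo : ((0 : ℕ)) * q < ((0 : ℕ) + 1) * p ∧ (0 : ℕ) * p < ((0 : ℕ) + 1) * q := by
      constructor <;> simp [hp.pos, hq.pos]
    refine target_ne_zero hp.two_le M hM ab v hex ((⟨0, hp.pos⟩, ⟨0, hq.pos⟩) : Fin p × Fin q) y
      (hfull _ hoo) 0 zero_le_one ⟨?_, ?_⟩
    · rw [hy1]; simp
    · rw [hy2]; simp
  · set t := T / 2 ^ c with htdef
    set T₀ := T % 2 ^ c with hT₀def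
    have hc : 0 < 2 ^ c := Nat.two_pow_pos c
    have ht : t ≤ 1 := by
      have : T / 2 ^ c < 2 := by
        rw [Nat.div_lt_iff_lt_mul hc]; rw [pow_succ] at hT; omega
      omega
    have hT₀ : T₀ < 2 ^ c := Nat.mod_lt _ hc
    have hTdec : T = 2 ^ c * t + T₀ := (Nat.div_add_mod T (2 ^ c)).symm
    obtain ⟨x, hx1, hx2⟩ : ∃ x : Fin p × Fin q, (x.1 : ℕ) = p * T₀ / 2 ^ c ∧ (x.2 : ℕ) = q * T₀ / 2 ^ c :=
      ⟨(⟨p * T₀ / 2 ^ c, (Nat.div_lt_iff_lt_mul hc).2 (Nat.mul_lt_mul_of_pos_left hT₀ hp.pos)⟩,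
        ⟨q * T₀ / 2 ^ c, (Nat.div_lt_iff_lt_mul hc).2 (Nat.mul_lt_mul_of_pos_left hT₀ hq.pos)⟩),
        rfl, rfl⟩
    have hxr : ∃ c T : ℕ, T < 2 ^ c ∧ (x.1 : ℕ) = p * T / 2 ^ c ∧ (x.2 : ℕ) = q * T / 2 ^ c :=
      ⟨c, T₀, hT₀, hx1, hx2⟩
    refine target_ne_zero hp.two_le M hM ab v hex x y (hfull x (cell_of_reach hp.pos hq.pos x hxr))
      t ht ⟨?_, ?_⟩
    · rw [hy1, hx1, hTdec, carry_step]
    · rw [hy2, hx2, hTdec, carry_step]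

include hπpos hπzero in
/-- The stationary vector is nonnegative. -/
theorem pi_nonneg (y : Fin p × Fin q) : 0 ≤ π y := by
  by_cases h : ∃ c T : ℕ, T < 2 ^ c ∧ (y.1 : ℕ) = p * T / 2 ^ c ∧ (y.2 : ℕ) = q * T / 2 ^ c
  · exact (hπpos y h).le
  · exact (hπzero y h).ge

include hM hπpos hπzero hπsum hΛ in
/-- Every generalized letter (the `M_{ab}` and `Π = 𝟙 ⊗ π`) has absolute row sums `≤ 1`. -/
theorem letter_rows : ∀ (l : Option (Bool × Bool)) (s : Fin p × Fin q), ∑ z, |Λ l s z| ≤ 1 := by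
  intro l s
  subst hΛ
  cases l with
  | none =>
    simp only [Option.elim_none, Matrix.of_apply]
    rw [Finset.sum_congr rfl fun z _ => abs_of_nonneg (pi_nonneg hπpos hπzero z), hπsum]
  | some ab =>
    simp only [Option.elim_some]
    exact sum_abs_letter_le M hM ab s

include hM hπzero hΛ in
/-- Generalized letters keep row vectors carried by the reachable states carried by them. -/
theorem letter_reach : ∀ (l : Option (Bool × Bool)) (s y : Fin p × Fin q),
    (∃ c T : ℕ, T < 2 ^ c ∧ (s.1 : ℕ) = p * T / 2 ^ c ∧ (s.2 : ℕ) = q * T / 2 ^ c) → Λ l s y ≠ 0 →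
    (∃ c T : ℕ, T < 2 ^ c ∧ (y.1 : ℕ) = p * T / 2 ^ c ∧ (y.2 : ℕ) = q * T / 2 ^ c) := by
  intro l s y hs h
  subst hΛ
  cases l with
  | none =>
    simp only [Option.elim_none, Matrix.of_apply] at h
    by_contra hy
    exact h (hπzero y hy)
  | some ab =>
    simp only [Option.elim_some] at h
    exact reach_step M hM ab s y hs h

/-- A word without the letter `none` is a plain word. -/
theorem exists_plain {α : Type*} : ∀ L : List (Option α), none ∉ L → ∃ X : List α, L = X.map some := by
  intro L
  induction L with
  | nil => intro _; exact ⟨[], rfl⟩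
  | cons l L ih =>
    intro h
    obtain ⟨X, hX⟩ := ih fun h' => h (List.mem_cons_of_mem _ h')
    cases l with
    | none => exact absurd List.mem_cons_self h
    | some a => exact ⟨a :: X, by rw [hX, List.map_cons]⟩

end SignAnalysis

/-- THE MIDDLE CELL KILLS `M₁₀`, `M₀₁` (registered sub-goal `stub_fstEqSnd` of
`stub_noExactTwistedCycle`, the letter written out): `fst_eq_snd`. -/
theorem stub_fstEqSnd :
    ∀ p q : ℕ, p.Prime → q.Prime → p ≠ q → 2 < p → 2 < q → ∀ a b : Bool, ∀ v : Fin p × Fin q → ℝ, (∀ x : Fin p × Fin q, (x.1 : ℕ) * q < ((x.2 : ℕ) + 1) * p ∧ (x.2 : ℕ) * p < ((x.1 : ℕ) + 1) * q → v x ≠ 0) → ∑ z : Fin p × Fin q, |Matrix.vecMul v (Matrix.of fun (x y : Fin p × Fin q) => ∑ t ∈ ({0, 1} : Finset ℕ), if (y.1 : ℕ) = (p * t + x.1) / 2 ∧ (y.2 : ℕ) = (q * t + x.2) / 2 then (1 / 2 : ℝ) * (if a then (-1 : ℝ) ^ ((p * t + x.1) % 2) else 1) * (if b then (-1 : ℝ)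 ^ ((q * t + x.2) % 2) else 1) else 0) z| = ∑ z : Fin p × Fin q, |v z| → a = b :=
  fun _ _ hp hq hpq hp2 hq2 a b v hfull hex =>
    fst_eq_snd hp hq hpq hp2 hq2 rfl a b v hfull hex

end Summit.QuantumAdvantage.QuantumAdvantage.Theorems.MobiusLadderQuadraticDigitPhasesStubNoExactB
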